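import Literature.Analysis.FluidPDE.CollisionWeakForm
import Literature.MathematicalPhysics.KineticTheory.HardSphereEuler
import HarnessLib

/-!
# Static tube-parity identity (rung-0 toolkit of the crux line `equilibrium-rung-mean-variance`,
# `JParityClosure.OddContactSymmetry`, stmt-AtomisticToContinuum-13078)

Helper file (`--supports stmt-AtomisticToContinuum-13078`, toward the registered stub `stub_meanParity` at
rung 0, i.e. constant profiles) making importable the two sorry-free lemmas that so far lived only in the
line's skeleton `Cruxes/OddContactSymmetry/Lines/equilibrium-rung-mean-variance.lean` (planner
`planner-cruxplan-stmt-AtomisticToContinuum-13078-equilibrium-rung-mea-0`, triage `Check.lean`; proofs copied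
verbatim):

* `tube_radius_J_invariant` — the pulled-back relative position after the inverse collision
  `J(ω, v, w) = (−ω, v′, w′)` has the same length, `‖−εω + τ′(w′ − v′)‖ = ‖εω + τ′(w − v)‖`;
* `staticTubeParity` — for every `ε, τ′`, every radial position factor `ρ₂`, every collision-invariant
  velocity weight `W` and every J-odd mark `Ψ`,
  `∫∫∫ Ψ(ω,v,w) ρ₂(‖εω + τ′(w−v)‖) W(v,w) ((w−v)·ω)₊ dv dw dω = 0`
  (the involution `J = T₂ ∘ T₁` preserves `dv dw dω`: tree `integral_comp_collideSwap_prod`,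
  `integral_comp_swap_negDir`).

Under the invariant canonical Gibbs law (constant profiles; `map_flow_localGibbsLaw_const` of
`JParityClosureOddContactSymmetryGibbsInvariance.lean`) the mean of the fixed-time tube functional reduces, after
the collision-cylinder change of variables, to integrals of exactly this shape; this identity is the parity half
of rung 0 of S3.  These lemmas concern the TRUNCATED/tube objects and are unaffected by the tightness defect of
the untruncated reweighting recorded in `Cruxes/OddContactSymmetry/BlowupAnalysis.md`.

References: C. Cercignani, R. Illner, M. Pulvirenti, *The Mathematical Theory of Dilute Gases* (1994), §3.1–3.2
(collision invariants, the involution `(v, w, ω) ↦ (v′, w′, −ω)`); H. Spohn, *Large Scale Dynamics of Interacting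
Particles* (1991), Part I §3.
-/

noncomputable section

open MeasureTheory Set
open scoped ENNReal InnerProductSpace BigOperators

namespace Summit.AtomisticToContinuum.HydrodynamicLimit.Theorems

open Literature.Analysis.FluidPDE Literature.MathematicalPhysics.KineticTheory

/-- **Tube geometry is J-invariant** (triage Check.lean `tube_radius_J_invariant`, re-proved here): the pulled-back
relative position after the inverse collision `J(ω,v,w) = (−ω, v′, w′)` has the same length,
`‖−εω + τ′(w′ − v′)‖ = ‖εω + τ′(w − v)‖` — `w′ − v′ = (w − v) + 2⟪v−w,ω⟫ω` is the mirror image of `w − v` across `ω^⊥`.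
[folklore] -/
theorem tube_radius_J_invariant (ε τ' : ℝ) (ω : Metric.sphere (0 : V3) 1) (v w : V3) :
    ‖ε • (((-ω : Metric.sphere (0 : V3) 1)) : V3) + τ' • ((collide ω (v, w)).2 - (collide ω (v, w)).1)‖ =
      ‖ε • (ω : V3) + τ' • (w - v)‖ := by
  have h1 : ⟪(ω : V3), (ω : V3)⟫_ℝ = 1 := real_inner_self_sphere ω
  set c : ℝ := ⟪v - w, (ω : V3)⟫_ℝ with hc
  have hcw : ⟪w - v, (ω : V3)⟫_ℝ = -c := by rw [hc, ← inner_neg_left, neg_sub]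
  have hL : ε • (((-ω : Metric.sphere (0 : V3) 1)) : V3) + τ' • ((collide ω (v, w)).2 - (collide ω (v, w)).1) =
      τ' • (w - v) + (2 * τ' * c - ε) • (ω : V3) := by
    simp only [collide, coe_neg_sphere, smul_neg, ← hc]
    module
  have hsq : ‖τ' • (w - v) + (2 * τ' * c - ε) • (ω : V3)‖ ^ 2 = ‖ε • (ω : V3) + τ' • (w - v)‖ ^ 2 := by
    have hcw' : ⟪(ω : V3), w - v⟫_ℝ = -c := by rw [real_inner_comm, hcw]
    rw [norm_add_sq_real, norm_add_sq_real]
    simp only [norm_smul, mul_pow, Real.norm_eq_abs, sq_abs, norm_eq_of_mem_sphere ω, inner_smul_left,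
      inner_smul_right, hcw, hcw', RCLike.conj_to_real, mul_one]
    ring
  rw [hL, ← Real.sqrt_sq (norm_nonneg (τ' • (w - v) + (2 * τ' * c - ε) • (ω : V3))),
    ← Real.sqrt_sq (norm_nonneg (ε • (ω : V3) + τ' • (w - v))), hsq]

/-- **Static tube-parity identity** (RUNG 0's key lemma = the ideator's `FirstLemmaC_equilibriumTubeParity`,
generalised from Maxwellian products to ANY velocity weight `W` invariant under the collision map, e.g.
`W(v,w) = M(v)M(w)` (energy conservation) or the reweighted `h(v)h(w) + h(v′)h(w′)` for an arbitrary one-body law `h`;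
PROVED, sorry-free).  For every `ε, τ′ ∈ ℝ`, every radial position factor `ρ₂ : ℝ → ℝ`, every collision-invariant `W`
and every J-odd mark `Ψ`:
`∫∫∫ Ψ(ω,v,w) · ρ₂(‖εω + τ′(w−v)‖) · W(v,w) · ((w−v)·ω)₊ dv dw dω = 0`.
No integrability hypothesis (the change of variables holds for every integrand; a non-integrable one has junk integral
`0` on both sides).  Proof: the involution `J = T₂ ∘ T₁`, `T₁(v,w,ω) = (w′,v′,ω)`, `T₂(v,w,ω) = (w,v,−ω)` preserves
`dv dw dω` (tree `integral_comp_collideSwap_prod`, `integral_comp_swap_negDir`); under `J` the mark flips sign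
(`hΨ` with `reflectVel_eq_collide`), the tube radius (`tube_radius_J_invariant`), `W` (`hW`) and the kernel
(`((w′−v′)·(−ω))₊ = ((w−v)·ω)₊`) are invariant, so `∫K = ∫K∘J = −∫K`.  Consequence for rung 0: under the canonical
Gibbs law (constant profiles) the two-body correlation on the tube is `ρ₂^{(N)}(‖q‖) M(v) M(w)` up to finite-size
anisotropy, the collision-cylinder change of variables `q = εω + τ′(w−v)`, `dq = ε²((w−v)·ω)₊ dτ′ dω` turns
`E_G[A_t]` into `∫₀^{τ₂}` of exactly this integral (with `χ, g` factors depending on `x_i` only), hence the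
`N → ∞` mean of the tube functional vanishes at every fixed `(r, ϑ, L, κ)` once `hm` has concentrated (S3 at rung 0;
triage sharpening 1). [folklore] -/
theorem staticTubeParity (ε τ' : ℝ) (ρ₂ : ℝ → ℝ) (W : V3 × V3 → ℝ)
    (Ψ : V3 × V3 × V3 → ℝ)
    (hW : ∀ (ω : Metric.sphere (0 : V3) 1) (p : V3 × V3), W (collide ω p) = W p)
    (hΨ : ∀ (n v w : V3), ‖n‖ = 1 →
      Ψ (-n, (reflectVel n (v, w)).1, (reflectVel n (v, w)).2) = -Ψ (n, v, w)) :
    ∫ q : (V3 × V3) × Metric.sphere (0 : V3) 1,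
        Ψ ((q.2 : V3), q.1.1, q.1.2) * ρ₂ ‖ε • (q.2 : V3) + τ' • (q.1.2 - q.1.1)‖ * W q.1 *
          hardSphereKernel (q.1.2, q.1.1) q.2
        ∂(((volume : Measure V3).prod volume).prod sphereMeasure) = 0 := by
  set μ : Measure ((V3 × V3) × Metric.sphere (0 : V3) 1) :=
    ((volume : Measure V3).prod volume).prod sphereMeasure with hμ
  set K : (V3 × V3) × Metric.sphere (0 : V3) 1 → ℝ := fun q =>
    Ψ ((q.2 : V3), q.1.1, q.1.2) * ρ₂ ‖ε • (q.2 : V3) + τ' • (q.1.2 - q.1.1)‖ * W q.1 *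
      hardSphereKernel (q.1.2, q.1.1) q.2 with hK
  -- pointwise oddness under J : (v, w, ω) ↦ (v', w', -ω)
  have hJ : ∀ q : (V3 × V3) × Metric.sphere (0 : V3) 1, K (collide q.2 q.1, -q.2) = -K q := by
    rintro ⟨⟨v, w⟩, ω⟩
    have hω : ‖(ω : V3)‖ = 1 := norm_eq_of_mem_sphere ω
    have h1 : ⟪(ω : V3), (ω : V3)⟫_ℝ = 1 := real_inner_self_sphere ω
    have hΨ' : Ψ ((((-ω : Metric.sphere (0 : V3) 1)) : V3), (collide ω (v, w)).1, (collide ω (v, w)).2) =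
        -Ψ ((ω : V3), v, w) := by
      have := hΨ (ω : V3) v w hω
      rw [reflectVel_eq_collide] at this
      simpa only [coe_neg_sphere] using this
    have hR := tube_radius_J_invariant ε τ' ω v w
    have hB : hardSphereKernel ((collide ω (v, w)).2, (collide ω (v, w)).1) (-ω) = hardSphereKernel (w, v) ω := by
      simp only [hardSphereKernel, collide, coe_neg_sphere, inner_neg_right, inner_sub_left, inner_add_left,
        inner_smul_left, h1, RCLike.conj_to_real]
      congr 1
      ring
    have hW' : W (collide ω (v, w)) = W (v, w) := hW ω (v, w)
    simp only [hK]
    rw [hΨ', hR, hB, hW']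
    ring
  -- change of variables `J = T₂ ∘ T₁` preserves `μ`
  have hI : ∫ q, K (collide q.2 q.1, -q.2) ∂μ = ∫ q, K q ∂μ := by
    have h1 := integral_comp_collideSwap_prod (E := V3) (fun q => K (q.1.swap, -q.2))
    have h2 := integral_comp_swap_negDir (E := V3) K
    simp only [Prod.swap_swap] at h1
    rw [hμ, h1, h2]
  have h0 : ∫ q, K q ∂μ = -∫ q, K q ∂μ := by
    calc ∫ q, K q ∂μ = ∫ q, K (collide q.2 q.1, -q.2) ∂μ := hI.symm
      _ = ∫ q, -K q ∂μ := integral_congr_ae (Filter.Eventually.of_forall hJ)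
      _ = -∫ q, K q ∂μ := integral_neg _
  have : ∫ q, K q ∂μ = 0 := by linarith
  simpa only [hK, hμ] using this

/-- **Registered helper stub `stub_staticTubeParity`** of crux stmt-AtomisticToContinuum-13078 (rung 0 of
`stub_meanParity`, line `equilibrium-rung-mean-variance`): the static tube-parity identity in signature form
(= `staticTubeParity`). [folklore] -/
theorem stub_staticTubeParity :
    ∀ (ε τ' : ℝ) (ρ₂ : ℝ → ℝ) (W : V3 × V3 → ℝ) (Ψ : V3 × V3 × V3 → ℝ),
      (∀ (ω : Metric.sphere (0 : V3) 1) (p : V3 × V3), W (collide ω p) = W p) →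
      (∀ (n v w : V3), ‖n‖ = 1 →
        Ψ (-n, (reflectVel n (v, w)).1, (reflectVel n (v, w)).2) = -Ψ (n, v, w)) →
      ∫ q : (V3 × V3) × Metric.sphere (0 : V3) 1,
          Ψ ((q.2 : V3), q.1.1, q.1.2) * ρ₂ ‖ε • (q.2 : V3) + τ' • (q.1.2 - q.1.1)‖ * W q.1 *
            hardSphereKernel (q.1.2, q.1.1) q.2
          ∂(((volume : Measure V3).prod volume).prod sphereMeasure) = 0 :=
  fun ε τ' ρ₂ W Ψ hW hΨ => staticTubeParity ε τ' ρ₂ W Ψ hW hΨ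

end Summit.AtomisticToContinuum.HydrodynamicLimit.Theorems

end
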